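import Mathlib
import HarnessLib
import HarnessLib.Audit
import Summits.HubbardSuperconductivity.Statement
import HarnessLib.Audit.Status.Attr

/-!
Route: ChernVortexResponse

DORMANT since 2026-08-29T21:01:39Z (census g0: costume (trib-confirmed census-trib-costume-A 2026-08-29; 21-frontier 19:16:23Z (b)); reversible --off) — unstaffed, not closed; items shared with open routes are served there. `ledger route dormant <id> --off` reactivates.

CHERN-CLASS VORTEX RESPONSE (realises idea card chern-class-vortex-spectroscopy; same observable as
the sibling card flux-quantum-vortex-tension). Pierce the SURFACE of the L×L torus with exactly ONE
quantum of uniform orbital flux — Landau-gauge Peierls phases on the bonds of (ℤ/L)², x : Fin 2 →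
ZMod L: A_L(x,e₁) = exp(2πi·x₀/L²) on every e₁-bond, A_L(x,e₀) = 1 except exp(−2πi·x₁/L) on the seam
column x₀ = L−1, so that EVERY plaquette holonomy equals exp(2πi/L²) and the total flux is exactly
2π (lattice first Chern number 1; support item OneFluxQuantum). These phases are the verbatim
unfolding of the lattice-gauge library's proved field `uniformFlux L`, written out inline so that
the route imports nothing beyond the summit Statement (route repairs 2026-08-15). They enter the
Hubbard hopping, no Zeeman term; keep the (N_L, S^z = 0) sector, N_L = 2⌊(1−δ)L²/2⌋, and read ONE
number: the flux response V_L(U,δ) := E_L^{flux}(N_L,0) − E_L^{0}(N_L,0) (difference of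
`Matrix.minEnergyOn` over `szSector N_L 0`). A charge-2e condensate cannot be combed on this torus
(its pair wavefunction is a section of a Chern-number-2 bundle, two vortices are forced, each costs
πρ_s·log(L/ξ) because the field is imposed on every plaquette), so V_L ≈ 2πρ_s·log L → ∞, while
normal states answer O(1) (metals; Assaad's size-effect reducer) or e^{−L/ξ} (insulators).
It suffices to show X = A ∧ B ∧ C (decl `Target`):
(A) HubbardVortexTension — ∃ U>0, δ∈(0,1/4), c>0: V_L(U,δ) ≥ c·log L for all large L (the witness;
rank 3);
(B) TensionForcesCondensate — ∀ U>0, δ∈(0,1/2): a log-divergent flux response forces Yang ODLRO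
(`HasODLRO`, a macroscopic eigenvalue of ρ₂) in EVERY normalised (N_L,0)-sector ground-state
sequence of `hubbardTorus 2 L 1 U` (the bridge 'stiffness under an unremovable flux ⇒ condensate';
rank 2);
(C) CondensateIsDWave — ∀ U>0, δ∈(0,1/4) in the same phase-stiff regime: such a condensate is seen
by the nearest-neighbour d_{x²−y²} pair field (`HasPairFieldLRO dWaveFormFactor`; rank 4).
Deciding theorem `closes` (items → HubbardSuperconductivity) is certified native-OK: take (U,δ) from
A (δ<1/4<1/2), feed the log hypothesis to B (ODLRO for every all-L-admissible sequence) and C (⇒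
HasPairFieldLRO dWaveFormFactor), then the PROVED glue
`hasDWavePairFieldLROAt_of_forall_hasPairFieldLRO` (Theorems/WeakCouplingBCSWcbcsThesis: odd sides
filled with arbitrary sector ground states, liminf passed to even sides) gives the Statement; the
legacy item Assembly (A → B → C → HubbardSuperconductivity) records that implication and `closes`
runs through it.
Lean (all decls elaborate without any Literature.Barriers import, `lean check` rc 0, dependency cone
49 project constants, all proved): X := HubbardVortexTension ∧ TensionForcesCondensate ∧
CondensateIsDWave, where V_L is written out over existing declarations as Matrix.minEnergyOn (−Σ_{x
: Fin 2 → ZMod L} Σ_{i : Fin 2} Σ_{σ : Fin 2} [↑(A_L x i) • (creation (orb (FermionTorus.ofTorusSite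
(x + Pi.single i 1)) σ) * annihilation (orb (FermionTorus.ofTorusSite x) σ)) + (starRingEnd ℂ) ↑(A_L
x i) • (creation (orb (FermionTorus.ofTorusSite x) σ) * annihilation (orb (FermionTorus.ofTorusSite
(x + Pi.single i 1)) σ))] + ↑U • Σ_y numberOp y 0 * numberOp y 1) (szSector N_L 0) −
Matrix.minEnergyOn (hubbardTorus 2 L 1 U) (szSector N_L 0), with A_L x i the explicit `Circle.exp`
phases above (if i = 1 then Circle.exp (2π/L²·(x 0).val) else if (x 0).val = L−1 then Circle.exp
(−(2π/L²)·L·(x 1).val) else 1).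

Rationale: WHY THIS LINE. Catalogue: topological reformulation + physical analogy WITH dictionary
(pair-condensate wavefunction ↦ section of the charge-2 line bundle over the flux torus; c₁ = 1 ↦
forced total vorticity 2; helicity modulus ρ_s ↦ coefficient of log L; 'normal' ↦ bounded response).
Superconductivity becomes the statement that a sector ground energy feels the first Chern class of a
line bundle, E(c₁=1) − E(c₁=0) ~ 2πρ_s log L, a DIVERGENT signal whose coefficient is the stiffness,
read off energies — the best-controlled many-body data (variational upper bounds, Temple/SDP lower
bounds, constructive expansions control energies before correlations). The forward picture is
theorem-grade at order-parameter level (GL on the flux torus: Aydi–Sandier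
doi:10.1016/j.anihpc.2008.09.004, Alama–Bronsard–Sandier doi:10.1007/s00526-009-0234-5;
ball-construction lower bounds of Bethuel–Brezis–Hélein/Sandier–Serfaty/Jerrard; BdG vortex lattices
with two hc/2e vortices per hc/e cell, Franz–Tešanović doi:10.1103/PhysRevLett.84.554); the normal
side is Assaad's finite-size device (arXiv:cond-mat/0104126 §3.2) and Kohn's flux-blind insulator
(doi:10.1103/PhysRev.133.A171). Nothing is imported into Lean beyond the summit Statement: the
one-flux-quantum field is the Landau-gauge unfolding of the lattice-gauge library's `uniformFlux`
(Literature/Barriers/QuantumFields/NoContinuousLatticeTopologicalCharge.lean, where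
`u1Plaquette_uniformFlux` / `u1Charge_uniformFlux` are proved), written out inline over Fin 2 → ZMod
L and re-certified inside the route by the support item OneFluxQuantum; that module itself is
deliberately NOT imported (route repairs 2026-08-15: it drags ConstructiveQFTWave0.lean and the
unrelated open problem CaoParkSheffieldProblem into the import cone), so the route's dependency cone
is 49 project constants, all proved, and every decl elaborates today. Tail: Yang ODLRO
(YangODLRO1962) + the Q-D5 pair-field notions (Scalapino1995) + the PROVED even-side glue of
Theorems/WeakCouplingBCSWcbcsThesis.
RANKED CRUXES. rank 2 TensionForcesCondensate: log-divergent V_L ⇒ HasODLRO for every sector GS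
sequence (converse of the proven direction ODLRO ⇒ flux quantisation/Meissner: Sewell
doi:10.1007/BF01013973, Nieh–Su–Zhao doi:10.1103/PhysRevB.51.3760; equivalently the 'vortex line
tension ⇒ U(1) order' input of card abelian-duality-vortex-peierls; Literature-grade if true). rank
3 HubbardVortexTension: the witness ∃U>0, δ∈(0,1/4): V_L ≥ c log L — a log-precision LOWER bound on
an energy difference, as deep as stiffness; expected as a corollary of a constructed superconductor
(WeakCouplingBCS-type outputs) or from a doubling/surgery inequality V_{2L} − V_L ≥ c' ('a vortex
cannot hide in a sub-torus'); not attacked directly here. rank 4 CondensateIsDWave: in the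
phase-stiff regime every Yang condensate of the repulsive model has B1g symmetry with
nearest-neighbour weight (δ < 1/4 because RaghuKivelsonScalapino2010 find non-B1g Kohn–Luttinger
channels for n ≲ 0.6). SUPPORT (provable now / calibration, rank 9): MagneticTorusWellPosed
(hermitian, [H,N] = [H,S^z] = 0, trivial phases reproduce hubbardTorus for L ≥ 3 — guards the
inlined definition); OneFluxQuantum (every plaquette holonomy of the inlined Landau-gauge field is
exp(2πi/L²), 0 < 2π/L² < π, for L ≥ 2 — the 'one quantum' certificate, candidate proof attached to
stmt-8615); FreeFermionCalibration (U = 0: |V_L| = o(log L); semiclassics of the one-flux-quantum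
Harper ring of length L² plus lattice-point bounds; stated o(log L) rather than O(1) per the novelty
audit's Gauss-circle caveat). Target = A ∧ B ∧ C (rank 5 only so that it renders after the decls it
names); Assembly (legacy item, kept: the deciding theorem `closes` runs through it) = A → B → C →
HubbardSuperconductivity, proved in the opener's folder.
KILL CRITERIA. B refuted (a phase-stiff sector-GS sequence without pair ODLRO: Bose metal or
charge-4e) closes the route. C refuted throughout δ<1/4 (condensate orthogonal to the n.n. B1g bond:
PDW, d_xy, extended-s, triplet) → one restate with an explicit channel datum (Klein-bottle half-flux
test of card flux-spectroscopy-klein-bottle), else close. A refuted (V_L = o(log L) for all U>0,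
δ<1/4) is a major energies-only NEGATIVE result feeding NoGo; the route closes but the diagnostic
survives. FreeFermionCalibration refuted (free response ≥ c log L at some δ) voids the dichotomy →
close.
NOT DECOMPOSED YET. Any mechanism for A; the GL/BdG calibration theorems (B-GL = Aydi–Sandier,
known; a lattice d-wave BdG functional with Peierls phases would be a NEW object, filed only if C or
A needs it); holonomy/gauge-class bookkeeping (the Landau-gauge field = uniformFlux fixes the
canonical representative; other holonomies differ by an Aharonov–Bohm twist ≤ 2π/L, an O(1) energy
effect for metals and superconductors alike); the T>0 quasi-LRO analogue; numerics (attractive-U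
DMRG calibration, stripe-box saturation) are instruments only.
CHEAPEST FALSIFIER. The U = 0 null line (support FreeFermionCalibration): V_L(0,δ) is a one-body
number — the sum of the N_L/2 lowest eigenvalues of ONE critical Harper ring of length L² (Landau
gauge + seam) minus the zero-field (2π/L)-grid sum — exactly computable to L ≈ 60 in seconds
(sibling card flux-quantum-vortex-tension: |V_L^free| ≤ 2.7 up to L = 40); a free response growing
like c·log L at some δ ∈ (0,1/2) voids the bounded-vs-log dichotomy and closes the route before any
many-body work. Next cheapest, against the mechanism of crux B: a solvable lattice pair-hopping /
hard-core boson torus with flux response ≥ c·log L and provably NO ODLRO (a lattice Gunther–Imry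
doi:10.1016/0038-1098(69)90378-0 or a charge-4e condensate doi:10.1038/nphys1389) — it would not
refute B's literal Hubbard statement but would mark the bridge as model-specific luck rather than a
principle.

Novelty: DELTA: (i) the dichotomy 'one-flux-quantum response V_L bounded (normal) vs V_L ≥ c·log L
(phase-stiff pair condensate)' for a SECTOR GROUND-ENERGY DIFFERENCE of interacting lattice
fermions, stated in Lean with the Landau-gauge Peierls phases written out over Fin 2 → ZMod L — the
unfolding of the PROVED lattice field `uniformFlux` of first Chern number exactly 1, the
one-flux-quantum identity restated inside the route as the support item OneFluxQuantum (no new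
definition; route repair 2026-08-15: the barrier module NoContinuousLatticeTopologicalCharge is no
longer needed by any decl — once its import line is dropped no unproved fact sits in the cone); (ii)
the converse 'log response ⇒ Yang ODLRO for every ground state' isolated as a named refutable bridge
(crux B) with its two known loopholes named (quasi-1D flux quantisation without ODLRO,
doi:10.1016/0038-1098(69)90378-0 Gunther–Imry 1969; charge-4e, doi:10.1038/nphys1389
Berg–Fradkin–Kivelson 2009); (iii) the d-wave tail closed by an already-proved glue theorem, so the
assembly is provable today; (iv) the free null statement posed as o(log L). NOT found in print: the
bounded-vs-log dichotomy as an order criterion for interacting lattice fermions, or any theorem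
'vortex tension / log flux response ⇒ ODLRO' at T = 0. Expected grade new-combination (card; the
sibling card flux-quantum-vortex-tension with the same observable was graded variant).
NEAREST PRIOR ART, searched this session with crossref + zbMATH (local index, gal  [refs: 10.1016/0038-1098(69, 10.1038/nphys1389, 10.1016/S0550-3213(99, 10.1016/j.anihpc.2008.09.004, 10.1063/1.4942632, 10.1103/PhysRevB.51.3760, 10.1063/1.532193, 10.1007/BF02732438, 10.1103/PhysRevB.47.7995, 10.1103/PhysRevLett.71.1915, 10.1103/PhysRevLett.84.554, 2012.12559, cond-mat/0104126, doi:10.1016/0038-1098, doi:10.1038/nphys1389, doi:10.1016/S0550-3213, doi:10.1016/j.anihpc.2008.09.004, doi:10]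

Barriers (technique_class: topological-flux-response vortex-lower-bound Chern-class): technique_class: topological-flux-response vortex-lower-bound Chern-class
- Literature.Barriers.HubbardSuperconductivity.WeakCouplingCeiling: NOT evaded by crux A
(HubbardVortexTension) and said so — at weak U the logarithm starts only at L ≫ ξ ~ exp(C/U²) and
inside every convergent weak-coupling regime V_L is provably bounded; A must come from a constructed
superconductor or a non-perturbative doubling inequality, witness aimed at intermediate U.
- Literature.Barriers.HubbardSuperconductivity.PerturbativeInvisibilityOfPairing: consistent —
nothing is read off a truncated U-series; the coefficient of log L is 2πρ_s, a non-perturbative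
stiffness.
- Literature.Barriers.HubbardSuperconductivity.SignProblemNPHard: relevant and conceded — orbital
Peierls phases make even the attractive model's determinant weights complex (det² ∉ ℝ₊), so every
numerical V_L (DMRG/AFQMC) is an instrument or kill switch, never a certificate; certificates exist
only at BdG/GL level.
- Literature.Barriers.HubbardSuperconductivity.PureModelStripeCompetition: the witness of A is NOT
sought in the cuprate box (U ∈ [6,8], δ = 1/8); the window δ < 1/4 is aimed at U ≈ 2–6 away from 1/8
stripes; in the box V_L should SATURATE, which makes the observable a cheap energies-only negative
instrument for route NoGo.
- Literature.Barriers.HubbardSuperconductivity.LROForcesLowLyingStates: consistent — V_L is a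
difference of sector MINIMA of two Hamiltonians; no gap, uniqueness or anomalous average ⟨Δ_d⟩ is
asserted;

History (route lifecycle, newest last):
- 2026-08-16T02:17:27Z · AUTO-CRUX: 1 conjecture-grade item(s) promoted to crux (OneFluxQuantum) — refuter vetting / tiering apply (operator:999:1362873)
- 2026-08-16T04:06:14Z · AUTO-CRUX (backfill): Target — hypotheses of the deciding theorem that nothing in the route derives are cruxes (operator:999:1085951)
- 2026-08-21T15:39:11Z · DORMANT — reconciler: no traction for 5 d (last activity statement-closed at 2026-08-16T15:21:24Z); parked, not closed — `ledger route dormant route-HubbardSuperconductiv (operator:999:598867)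
- 2026-08-29T08:50:40Z · REACTIVATED — reconciler: reactivated — activity statement-closed at 2026-08-29T07:52:55Z after parking at 2026-08-21T15:39:11Z (operator:999:938508)
- 2026-08-29T21:01:39Z · DORMANT — census g0: costume (trib-confirmed census-trib-costume-A 2026-08-29; 21-frontier 19:16:23Z (b)); reversible --off (operator:999:1722254)

sub-problem: HubbardSuperconductivity · status: dormant · opened planner-plancard-HubbardSuperconductivity-Hub-a573cd8b-0 2026-08-15T10:53:22Z · rev 6 · ledger route-HubbardSuperconductivity-ChernVortexResponse
GENERATED by the gate from the ledger (D-0016/17). Provers cite these decls: `theorem foo : Summit.HubbardSuperconductivity.HubbardSuperconductivity.Theses.ChernVortexResponse.<Decl> := …` in Summits/HubbardSuperconductivity/HubbardSuperconductivity/Theorems/<Name>.lean.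
-/

namespace Summit.HubbardSuperconductivity.HubbardSuperconductivity.Theses.ChernVortexResponse

open scoped BigOperators Topology Manifold Classical MeasureTheory ProbabilityTheory Matrix InnerProductSpace ComplexConjugate ContinuousMap
open Filter Set Function TopologicalSpace MeasureTheory

attribute [summit_statement] _root_.HubbardSuperconductivity

open Literature.Hubbard

/-- item stmt-HubbardSuperconductivity-1190 · crux · rank 2 · open · by planner
why it might fail: No theorem stiffness ⇒ ODLRO at T=0 (LSSY2005 Ch.5 p.40: relation open; 1D hard-core bosons are superfluid without BEC; Gunther–Imry quasi-1D); ∀(U,δ)∈(0,∞)×(0,½) exposes it to any charge-4e/quartet window (4 forced vortices: V_L ~ log L, no O(N) ρ₂ eigenvalue) anywhere in the diagram.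
sources: LiebSeiringerSolovejYngvason2005, GuntherImry1969, BergFradkinKivelson2009, Sewell1990, NiehSuZhao1995, PiguetWangGruber1997
[crux] BRIDGE (rank 2): for every U>0, δ∈(0,1/2): if the one-flux-quantum response V_L(U,δ) =
E_L^{flux}(N_L,0) − E_L^{0}(N_L,0) is ≥ c·log L for all large L (phase stiffness against an
unremovable c₁=1 twist), then EVERY normalised (N_L,S^z=0)-sector ground-state sequence of
hubbardTorus 2 L 1 U has Yang ODLRO (HasODLRO: a unit pair wavefunction with ρ₂-Rayleigh quotient ≥
c'N_L eventually). Converse of the proven direction ODLRO ⇒ flux quantisation/Meissner (Sewell,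
Nieh–Su–Zhao, Piguet–Wang–Gruber); dual reading: vortex line tension ⇒ U(1) order (input of card
abelian-duality-vortex-peierls). Literature-grade if true; stated for all large L (odd sides
included) so that the all-L glue applies. -/
@[route_item "route-HubbardSuperconductivity-ChernVortexResponse", crux]
def TensionForcesCondensate : Prop :=
  open Literature.MathematicalPhysics.QuantumLattice in ∀ (U δ : ℝ), 0 < U → δ ∈ Set.Ioo (0 : ℝ) (1 / 2) → (∃ c : ℝ, 0 < c ∧ ∃ L₀ : ℕ, ∀ (L : ℕ) [NeZero L], L₀ ≤ L → c * Real.log (L : ℝ) ≤ (Matrix.minEnergyOn (-(∑ x : (Fin 2 → ZMod L), ∑ i : Fin 2, ∑ σ : Fin 2, (((if i = 1 then Circle.exp (2 * Real.pi / (L : ℝ) ^ 2 * ((x 0).val : ℝ)) else if (x 0).val = L - 1 then Circle.exp (-(2 * Real.pi / (L : ℝ) ^ 2 * (L : ℝ) * ((x 1).val : ℝ))) else 1 : Circle) : ℂ) • (creation (orb (FermionTorus.ofTorusSite (x + Pi.single i 1)) σ) * annihilation (orb (FermionTorus.ofTorusSite x) σ)) + (starRingEnd ℂ) ((if i = 1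 then Circle.exp (2 * Real.pi / (L : ℝ) ^ 2 * ((x 0).val : ℝ)) else if (x 0).val = L - 1 then Circle.exp (-(2 * Real.pi / (L : ℝ) ^ 2 * (L : ℝ) * ((x 1).val : ℝ))) else 1 : Circle) : ℂ) • (creation (orb (FermionTorus.ofTorusSite x) σ) * annihilation (orb (FermionTorus.ofTorusSite (x + Pi.single i 1)) σ)))) + ((U : ℝ) : ℂ) • ∑ y : FermionTorus 2 L, numberOp y 0 * numberOp y 1) (szSector (2 * ⌊(1 - δ) * (L : ℝ) ^ 2 / 2⌋₊) 0) - Matrix.minEnergyOn (hubbardTorus 2 L 1 U) (szSector (2 * ⌊(1 - δ) * (L : ℝ) ^ 2 / 2⌋₊) 0))) → ∀ (N : ℕ → ℕ) (ψ : ∀ L, Fock (Orb (FermionTorus 2 L))), (∀ L, N L = (2 * ⌊(1 - δ) * (L : ℝ) ^ 2 / 2⌋₊) ∧ star (ψ L) ⬝ᵥ ψ L = 1 ∧ IsGroundStateInSector (hubbardTorus 2 L 1 U) (N L) 0 (ψ L)) → HasODLRO N ψ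

/-- item stmt-HubbardSuperconductivity-1191 · crux · rank 3 · open · by planner
why it might fail: Pure t'=0 model may have no stiff pair condensate at any U>0, δ<1/4: stripes and Δ_∞≈0 at U=8, δ=1/8; Δ_∞=0.006(4) at U=4, δ≈1/6 (Qin 2020; Xu 2024); weak-U KL pairing gives the log only for L ≫ ξ ~ e^{C/U²}; vortex-energy lower bounds exist only for GL/BCS functionals, not many-body.
sources: QinEtAl2020, XuEtAl2024, AydiSandier2009, doi:10.2140/pmp.2023.4.1, RaghuKivelsonScalapino2010, DengEtAl2015
[crux] WITNESS (rank 3): ∃ U>0, δ∈(0,1/4), c>0, L₀: for all L ≥ L₀ the flux response of the pure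
t'=0 repulsive Hubbard torus satisfies V_L(U,δ) ≥ c·log L (one flux quantum weighs log L: two forced
hc/2e vortices, each πρ_s log(L/ξ)). A log-precision LOWER bound on a difference of two sector
ground energies — hopeless by certification (needs o(log L/L²) per site), so it must come from
structure: a constructed superconductor (WeakCouplingBCS-type outputs give it as a corollary) or a
doubling/surgery inequality V_{2L} − V_L ≥ c' ('a vortex cannot hide in a sub-torus'). Imported, not
attacked, by this route; window δ<1/4 aimed at U≈2–6, away from the 1/8 stripe box. -/
@[route_item "route-HubbardSuperconductivity-ChernVortexResponse", crux]
def HubbardVortexTension : Prop :=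
  open Literature.MathematicalPhysics.QuantumLattice in ∃ U : ℝ, 0 < U ∧ ∃ δ ∈ Set.Ioo (0 : ℝ) (1 / 4), (∃ c : ℝ, 0 < c ∧ ∃ L₀ : ℕ, ∀ (L : ℕ) [NeZero L], L₀ ≤ L → c * Real.log (L : ℝ) ≤ (Matrix.minEnergyOn (-(∑ x : (Fin 2 → ZMod L), ∑ i : Fin 2, ∑ σ : Fin 2, (((if i = 1 then Circle.exp (2 * Real.pi / (L : ℝ) ^ 2 * ((x 0).val : ℝ)) else if (x 0).val = L - 1 then Circle.exp (-(2 * Real.pi / (L : ℝ) ^ 2 * (L : ℝ) * ((x 1).val : ℝ))) else 1 : Circle) : ℂ) • (creation (orb (FermionTorus.ofTorusSite (x + Pi.single i 1)) σ) * annihilation (orb (FermionTorus.ofTorusSite x) σ)) + (starRingEnd ℂ) ((if i = 1 then Circle.exp (2 * Real.pi / (L : ℝ) ^ 2 * ((x 0).val : ℝ)) else if (x 0).val = L - 1 then Circle.exp (-(2 * Real.pi / (L : ℝ) ^ 2 * (L : ℝ) * ((x 1).val : ℝ))) else 1 : Circle) : ℂ) • (creation (orb (FermionTorus.ofTorusSite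 x) σ) * annihilation (orb (FermionTorus.ofTorusSite (x + Pi.single i 1)) σ)))) + ((U : ℝ) : ℂ) • ∑ y : FermionTorus 2 L, numberOp y 0 * numberOp y 1) (szSector (2 * ⌊(1 - δ) * (L : ℝ) ^ 2 / 2⌋₊) 0) - Matrix.minEnergyOn (hubbardTorus 2 L 1 U) (szSector (2 * ⌊(1 - δ) * (L : ℝ) ^ 2 / 2⌋₊) 0)))

/-- item stmt-HubbardSuperconductivity-1192 · crux · rank 4 · open · by planner
why it might fail: ∀U>0 reaches strong coupling, where a stiff Yang condensate may be invisible to the uniform n.n. B1g bond: PDW/striped SC (finite-momentum ρ₂ eigenvector), triplet p/f-wave, extended-s, d_xy (RKS2010/Deng2015: non-B1g channels for n≲0.6); controlled diagMC certifies d_{x²−y²} only to U≈3–4, n<0.7.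
sources: RaghuKivelsonScalapino2010, SimkovicDengKozik2021, DengEtAl2015, BergFradkinKivelson2009, Scalapino1995, ArovasBergKivelsonRaghu2022
[crux] CHANNEL (rank 4): for U>0, δ∈(0,1/4), in the phase-stiff regime (V_L ≥ c log L eventually),
every admissible sector ground-state sequence with Yang ODLRO has d_{x²−y²} PAIR-FIELD long-range
order (HasPairFieldLRO dWaveFormFactor: the macroscopic ρ₂ weight is seen by the nearest-neighbour
B1g bond field, ⟨Δ_d†Δ_d⟩ = φ_d†ρ₂φ_d ≥ cL⁴). The repulsive on-site U kills the s-wave on-site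
amplitude in any condensate wavefunction; B1g with n.n. weight is what every method finds for n >
0.75; the statement is the 'overlap clause' of the Q-D5 bridge made unconditional inside the stiff
regime. -/
@[route_item "route-HubbardSuperconductivity-ChernVortexResponse", crux]
def CondensateIsDWave : Prop :=
  open Literature.MathematicalPhysics.QuantumLattice in ∀ (U δ : ℝ), 0 < U → δ ∈ Set.Ioo (0 : ℝ) (1 / 4) → (∃ c : ℝ, 0 < c ∧ ∃ L₀ : ℕ, ∀ (L : ℕ) [NeZero L], L₀ ≤ L → c * Real.log (L : ℝ) ≤ (Matrix.minEnergyOn (-(∑ x : (Fin 2 → ZMod L), ∑ i : Fin 2, ∑ σ : Fin 2, (((if i = 1 then Circle.exp (2 * Real.pi / (L : ℝ) ^ 2 * ((x 0).val : ℝ)) else if (x 0).val = L - 1 then Circle.exp (-(2 * Real.pi / (L : ℝ) ^ 2 * (L : ℝ) * ((x 1).val : ℝ))) else 1 : Circle) : ℂ) • (creation (orb (FermionTorus.ofTorusSite (x + Pi.single i 1)) σ) * annihilation (orb (FermionTorus.ofTorusSite x) σ)) + (starRingEnd ℂ) ((if i = 1 then Circle.exp (2 * Real.pi / (L : ℝ)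 ^ 2 * ((x 0).val : ℝ)) else if (x 0).val = L - 1 then Circle.exp (-(2 * Real.pi / (L : ℝ) ^ 2 * (L : ℝ) * ((x 1).val : ℝ))) else 1 : Circle) : ℂ) • (creation (orb (FermionTorus.ofTorusSite x) σ) * annihilation (orb (FermionTorus.ofTorusSite (x + Pi.single i 1)) σ)))) + ((U : ℝ) : ℂ) • ∑ y : FermionTorus 2 L, numberOp y 0 * numberOp y 1) (szSector (2 * ⌊(1 - δ) * (L : ℝ) ^ 2 / 2⌋₊) 0) - Matrix.minEnergyOn (hubbardTorus 2 L 1 U) (szSector (2 * ⌊(1 - δ) * (L : ℝ) ^ 2 / 2⌋₊) 0))) → ∀ (N : ℕ → ℕ) (ψ : ∀ L, Fock (Orb (FermionTorus 2 L))), (∀ L, N L = (2 * ⌊(1 - δ) * (L : ℝ) ^ 2 / 2⌋₊) ∧ star (ψ L) ⬝ᵥ ψ L = 1 ∧ IsGroundStateInSector (hubbardTorus 2 L 1 U) (N L) 0 (ψ L)) → HasODLRO N ψ → HasPairFieldLRO dWaveFormFactor N ψ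

/-- item stmt-HubbardSuperconductivity-1193 · crux (kind.auto-crux: conjecture-grade) · rank 5 · open · by planner
why it might fail: X = A ∧ B ∧ C dies with any conjunct: A has no documented witness in the pure t'=0 model (no pairing order at any computed intermediate-U point), B is an unproved converse with 1D/T>0 and charge-4e analogues against it, C is uncontrolled for U ≳ 4.
sources: QinEtAl2020, XuEtAl2024, BergFradkinKivelson2009, LiebSeiringerSolovejYngvason2005, SimkovicDengKozik2021
[target] X = A ∧ B ∧ C: the witness (HubbardVortexTension), the bridge (TensionForcesCondensate) and
the channel clause (CondensateIsDWave). Rank 5 only so that the gate renders it after the three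
decls it names (renderer orders target/cruxes by rank); it keys no staffing. -/
@[route_item "route-HubbardSuperconductivity-ChernVortexResponse", crux]
def Target : Prop :=
  HubbardVortexTension ∧ TensionForcesCondensate ∧ CondensateIsDWave

/-- item stmt-HubbardSuperconductivity-8615 · crux (kind.auto-crux: conjecture-grade) · rank 9 · closed · proved by Summit.HubbardSuperconductivity.HubbardSuperconductivity.Theorems.ChernVortexResponse.oneFluxQuantum_proof @ 104dd07a12b6 (prover) · by planner
why it might fail: auto-crux — conjecture-grade statement (docstring avows it ('open problem')); it is open, so it may simply be false
sources: Luscher1999AbelianTopology, arXiv:cond-mat/0104126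
[support] ONE FLUX QUANTUM (definition guard, provable now; candidate proof attached): for L ≥ 2 the
inline Landau-gauge phase field A_L of the route's magnetic Hubbard torus (A_L(x,e₁) =
exp(2πi·x₀/L²); A_L(x,e₀) = 1 except exp(−2πi·x₁/L) on the seam column x₀ = L−1; x : Fin 2 → ZMod L,
coordinates by ZMod.val) has EVERY plaquette holonomy A(x,e₀)·A(x+e₀,e₁)·A(x+e₁,e₀)⁻¹·A(x,e₁)⁻¹
equal to exp(2πi/L²), with 0 < 2π/L² < π — so the principal flux per plaquette is 2π/L² and the
total flux through the L×L torus is exactly 2π (lattice first Chern number 1: the 'one quantum' the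
thesis speaks of). This is `Literature.Barriers.QuantumFields.u1Plaquette_uniformFlux` /
`u1Charge_uniformFlux` transported to the inlined field (the phases are the verbatim unfolding of
`uniformFlux L`); it replaces the certification that previously rode on importing that barrier
module, which is deliberately NOT imported any more (it drags ConstructiveQFTWave0.lean and the
unrelated open problem CaoParkSheffieldProblem into the cone). Stated with a universally quantified
A pinned by the defining equation so the phase text is literally the one inlined in
HubbardVortexTension / TensionForcesCondensate / Condensa -/
@[route_item "route-HubbardSuperconductivity-ChernVortexResponse", crux]
def OneFluxQuantum : Prop :=
  open Literature.MathematicalPhysics.QuantumLattice in ∀ (L : ℕ) [NeZero L], 2 ≤ L → (0 < 2 * Real.pi / (L : ℝ) ^ 2 ∧ 2 * Real.pi / (L : ℝ) ^ 2 < Real.pi) ∧ ∀ A : (Fin 2 → ZMod L) → Fin 2 → Circle, (∀ (x : Fin 2 → ZMod L) (i : Fin 2), A x i = (if i = 1 then Circle.exp (2 * Real.pi / (L : ℝ) ^ 2 * ((x 0).val : ℝ)) else if (x 0).val = L - 1 then Circle.exp (-(2 * Real.pi / (L : ℝ) ^ 2 * (L : ℝ) * ((x 1).val : ℝ))) else 1))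 → ∀ x : Fin 2 → ZMod L, A x 0 * A (x + Pi.single 0 1) 1 * (A (x + Pi.single 1 1) 0)⁻¹ * (A x 1)⁻¹ = Circle.exp (2 * Real.pi / (L : ℝ) ^ 2)

-- `OneFluxQuantum` holds: proved by `Summit.HubbardSuperconductivity.HubbardSuperconductivity.Theorems.ChernVortexResponse.oneFluxQuantum_proof` @ 104dd07a12b6 (its module imports this route file, so no `_holds` link can be stated here).

/-- item stmt-HubbardSuperconductivity-1194 · support · rank 9 · closed · proved by Summit.HubbardSuperconductivity.HubbardSuperconductivity.Theorems.ChernVortexResponse.magneticTorusWellPosed_proof @ 104dd07a12b6 (prover) · by planner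
sources: arXiv:cond-mat/0104126
[support] Definition guard, provable now: for L ≥ 3 and every U the inlined one-flux-quantum Hubbard
Hamiltonian H_A = −Σ_{x,i,σ}[A(x,i) c†_{x+e_i,σ}c_{x,σ} + conj(A(x,i)) c†_{x,σ}c_{x+e_i,σ}] + U Σ_y
n_{y↑}n_{y↓} with A = uniformFlux L is Hermitian, conserves the particle number and S^z (so
Matrix.minEnergyOn over szSector N 0 is a sector eigenvalue), and with all Peierls phases replaced
by 1 it is literally hubbardTorus 2 L 1 U (each nearest-neighbour bond of (ℤ/L)² is exactly one
(x,i), both orientations present; fails for L = 2 by double counting, hence 3 ≤ L). Tools: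
conjTranspose of creation/annihilation products, numberAt_commute, fermionTorusGraph_adj,
toTorusSite_ofTorusSite. -/
@[route_item "route-HubbardSuperconductivity-ChernVortexResponse", crux]
def MagneticTorusWellPosed : Prop :=
  open Literature.MathematicalPhysics.QuantumLattice in ∀ (L : ℕ) [NeZero L], 3 ≤ L → ∀ U : ℝ, Matrix.IsHermitian (-(∑ x : (Fin 2 → ZMod L), ∑ i : Fin 2, ∑ σ : Fin 2, (((if i = 1 then Circle.exp (2 * Real.pi / (L : ℝ) ^ 2 * ((x 0).val : ℝ)) else if (x 0).val = L - 1 then Circle.exp (-(2 * Real.pi / (L : ℝ) ^ 2 * (L : ℝ) * ((x 1).val : ℝ))) else 1 : Circle) : ℂ) • (creation (orb (FermionTorus.ofTorusSite (x + Pi.single i 1)) σ) * annihilation (orb (FermionTorus.ofTorusSite x) σ)) + (starRingEnd ℂ) ((if i = 1 then Circle.exp (2 * Real.pi / (L : ℝ) ^ 2 * ((x 0).val : ℝ)) else if (x 0).val = L - 1 then Circle.exp (-(2 * Real.pi / (L : ℝ) ^ 2 * (L : ℝ) * ((x 1).val : ℝ))) else 1 : Circle) : ℂ) • (creation (orb (FermionTorus.ofTorusSite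 x) σ) * annihilation (orb (FermionTorus.ofTorusSite (x + Pi.single i 1)) σ)))) + ((U : ℝ) : ℂ) • ∑ y : FermionTorus 2 L, numberOp y 0 * numberOp y 1) ∧ Commute (-(∑ x : (Fin 2 → ZMod L), ∑ i : Fin 2, ∑ σ : Fin 2, (((if i = 1 then Circle.exp (2 * Real.pi / (L : ℝ) ^ 2 * ((x 0).val : ℝ)) else if (x 0).val = L - 1 then Circle.exp (-(2 * Real.pi / (L : ℝ) ^ 2 * (L : ℝ) * ((x 1).val : ℝ))) else 1 : Circle) : ℂ) • (creation (orb (FermionTorus.ofTorusSite (x + Pi.single i 1)) σ) * annihilation (orb (FermionTorus.ofTorusSite x) σ)) + (starRingEnd ℂ) ((if i = 1 then Circle.exp (2 * Real.pi / (L : ℝ) ^ 2 * ((x 0).val : ℝ)) else if (x 0).val = L - 1 then Circle.exp (-(2 * Real.pi / (L : ℝ) ^ 2 * (L : ℝ) * ((x 1).val : ℝ))) else 1 : Circle) : ℂ) • (creation (orb (FermionTorus.ofTorusSite x) σ) * annihilation (orb (FermionTorus.ofTorusSite (x + Pi.single i 1)) σ)))) + ((U : ℝ) : ℂ) • ∑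 y : FermionTorus 2 L, numberOp y 0 * numberOp y 1) totalNumber ∧ Commute (-(∑ x : (Fin 2 → ZMod L), ∑ i : Fin 2, ∑ σ : Fin 2, (((if i = 1 then Circle.exp (2 * Real.pi / (L : ℝ) ^ 2 * ((x 0).val : ℝ)) else if (x 0).val = L - 1 then Circle.exp (-(2 * Real.pi / (L : ℝ) ^ 2 * (L : ℝ) * ((x 1).val : ℝ))) else 1 : Circle) : ℂ) • (creation (orb (FermionTorus.ofTorusSite (x + Pi.single i 1)) σ) * annihilation (orb (FermionTorus.ofTorusSite x) σ)) + (starRingEnd ℂ) ((if i = 1 then Circle.exp (2 * Real.pi / (L : ℝ) ^ 2 * ((x 0).val : ℝ)) else if (x 0).val = L - 1 then Circle.exp (-(2 * Real.pi / (L : ℝ) ^ 2 * (L : ℝ) * ((x 1).val : ℝ))) else 1 : Circle) : ℂ) • (creation (orb (FermionTorus.ofTorusSite x) σ) * annihilation (orb (FermionTorus.ofTorusSite (x + Pi.single i 1)) σ)))) + ((U : ℝ) : ℂ) • ∑ y : FermionTorus 2 L, numberOp y 0 * numberOp y 1) HubbardWave0.spinZ ∧ (-(∑ x : (Fin 2 →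 ZMod L), ∑ i : Fin 2, ∑ σ : Fin 2, (creation (orb (FermionTorus.ofTorusSite (x + Pi.single i 1)) σ) * annihilation (orb (FermionTorus.ofTorusSite x) σ) + creation (orb (FermionTorus.ofTorusSite x) σ) * annihilation (orb (FermionTorus.ofTorusSite (x + Pi.single i 1)) σ))) + ((U : ℝ) : ℂ) • ∑ y : FermionTorus 2 L, numberOp y 0 * numberOp y 1) = hubbardTorus 2 L 1 U

-- `MagneticTorusWellPosed` holds: proved by `Summit.HubbardSuperconductivity.HubbardSuperconductivity.Theorems.ChernVortexResponse.magneticTorusWellPosed_proof` @ 104dd07a12b6 (its module imports this route file, so no `_holds` link can be stated here).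

/-- item stmt-HubbardSuperconductivity-1195 · support · rank 9 · open · by planner
why it might fail: Uniform O(1) may fail on rare L by Gauss-circle shell fluctuations; o(log L) should not — unless the seam/holonomy of uniformFlux produces an unforeseen resonance of the critical Harper ring near the Fermi level.
sources: arXiv:cond-mat/0104126, doi:10.1103/PhysRev.133.A171
[support] The normal-state null experiment (Theorem A of the card), stated robustly: at U = 0, for
every δ∈(0,1/2) and ε>0, |V_L(0,δ)| ≤ ε·log L for all large L (free fermions are blind to one flux
quantum up to o(log L)). Zero field: the sum of the N_L/2 lowest values of −2cos k₁ − 2cos k₂ on the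
(2π/L)-grid; one flux quantum: the spectrum of ONE critical almost-Mathieu/Harper ring of length L²
at frequency 1/L² (Landau gauge + seam; sibling card's exact reduction, |V_L^free| ≤ 2.7 numerically
to L = 40). Proof route: Legendre form E(N) = max_μ [Nμ + Σ(ε_j − μ)_−], Poisson/lattice-point bound
O(L^{-1/2}) for the grid Riesz mean at a curved Fermi level (δ>0 keeps μ<0, away from the van Hove
square), Bohr–Sommerfeld for the Harper ring below the separatrix. Stated o(log L), not O(1), per
the novelty audit's Gauss-circle caveat; not load-bearing for the assembly. -/
@[route_item "route-HubbardSuperconductivity-ChernVortexResponse", crux]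
def FreeFermionCalibration : Prop :=
  open Literature.MathematicalPhysics.QuantumLattice in ∀ δ ∈ Set.Ioo (0 : ℝ) (1 / 2), ∀ ε : ℝ, 0 < ε → ∃ L₀ : ℕ, ∀ (L : ℕ) [NeZero L], L₀ ≤ L → |(Matrix.minEnergyOn (-(∑ x : (Fin 2 → ZMod L), ∑ i : Fin 2, ∑ σ : Fin 2, (((if i = 1 then Circle.exp (2 * Real.pi / (L : ℝ) ^ 2 * ((x 0).val : ℝ)) else if (x 0).val = L - 1 then Circle.exp (-(2 * Real.pi / (L : ℝ) ^ 2 * (L : ℝ) * ((x 1).val : ℝ))) else 1 : Circle) : ℂ) • (creation (orb (FermionTorus.ofTorusSite (x + Pi.single i 1)) σ) * annihilation (orb (FermionTorus.ofTorusSite x) σ)) + (starRingEnd ℂ) ((if i = 1 then Circle.exp (2 * Real.pi / (L : ℝ) ^ 2 * ((x 0).val : ℝ)) else if (x 0).val = L - 1 then Circle.exp (-(2 * Real.pi / (L : ℝ) ^ 2 * (L : ℝ) * ((x 1).val : ℝ))) else 1 : Circle) : ℂ) • (creation (orb (FermionTorus.ofTorusSite x) σ) * annihilation (orb (FermionTorus.ofTorusSite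 (x + Pi.single i 1)) σ)))) + ((0 : ℝ) : ℂ) • ∑ y : FermionTorus 2 L, numberOp y 0 * numberOp y 1) (szSector (2 * ⌊(1 - δ) * (L : ℝ) ^ 2 / 2⌋₊) 0) - Matrix.minEnergyOn (hubbardTorus 2 L 1 0) (szSector (2 * ⌊(1 - δ) * (L : ℝ) ^ 2 / 2⌋₊) 0))| ≤ ε * Real.log (L : ℝ)

/-- item stmt-HubbardSuperconductivity-14308 · support · rank 9 · closed · proved by Summit.HubbardSuperconductivity.HubbardSuperconductivity.Theorems.ChernVortexResponse.targetOfCruxes_proof (prover) · by planner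
[support] GLUE (provable now, one line): the target X = A ∧ B ∧ C (decl Target) follows from the
three cruxes — A = HubbardVortexTension (witness), B = TensionForcesCondensate (bridge), C =
CondensateIsDWave (channel) — by And.intro; proof `fun hA hB hC => ⟨hA, hB, hC⟩` checked in the
planner folder (Sketch.lean, lean check rc 0, kernel-closed). Filed so that Target is reached from
the cruxes (route.target-unreachable repair, 2026-08-16); keys no staffing, anyone idle may land it
as `theorem … : ChernVortexResponse.TargetOfCruxes`. [deps: HubbardVortexTension,
TensionForcesCondensate, CondensateIsDWave, Target] [difficulty: provable-now] -/
@[route_item "route-HubbardSuperconductivity-ChernVortexResponse"]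
def TargetOfCruxes : Prop :=
  HubbardVortexTension → TensionForcesCondensate → CondensateIsDWave → Target

-- `TargetOfCruxes` holds: proved by `Summit.HubbardSuperconductivity.HubbardSuperconductivity.Theorems.ChernVortexResponse.targetOfCruxes_proof` (its module imports this route file, so no `_holds` link can be stated here).

/-- item stmt-HubbardSuperconductivity-1196 · assembly · rank 1 · closed · proved by Summit.HubbardSuperconductivity.HubbardSuperconductivity.Theorems.ChernVortexResponse.chernVortexResponse_assembly_proof @ 9922ea7f2993 (prover) · by planner
sources: Scalapino1995
[assembly] HubbardVortexTension → TensionForcesCondensate → CondensateIsDWave →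
HubbardSuperconductivity. PROVED in the planner folder (SketchAssembly.lean, attached as evidence):
take (U,δ) from A (δ<1/4<1/2), feed the log hypothesis to B (ODLRO for every all-L-admissible
sequence) and C (⇒ HasPairFieldLRO dWaveFormFactor), then
Summit...Theorems.hasDWavePairFieldLROAt_of_forall_hasPairFieldLRO (δ ≥ −1; fills odd sides with
exists_unit_isGroundStateInSector_hubbardTorus and passes the liminf to even sides) and unfold
HubbardSuperconductivity. Needs import
Summits.HubbardSuperconductivity.HubbardSuperconductivity.Theorems.WeakCouplingBCSWcbcsThesis in the
Theorems file. -/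
@[route_item "route-HubbardSuperconductivity-ChernVortexResponse", crux]
def Assembly : Prop :=
  HubbardVortexTension → TensionForcesCondensate → CondensateIsDWave → HubbardSuperconductivity

-- `Assembly` holds: proved by `Summit.HubbardSuperconductivity.HubbardSuperconductivity.Theorems.ChernVortexResponse.chernVortexResponse_assembly_proof` @ 9922ea7f2993 (its module imports this route file, so no `_holds` link can be stated here).

/-! D-0027 §2.1 — DECIDING THEOREM (planner-authored via `route open/edit --closes-file`; by operator:999:239538 2026-08-15T15:51:52Z):
its hypotheses are this route's items and its conclusion the sub-problem Statement (glue_lint), and it elaborates with this file. -/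

@[closes "route-HubbardSuperconductivity-ChernVortexResponse"] theorem closes : TensionForcesCondensate → HubbardVortexTension → CondensateIsDWave → Target → MagneticTorusWellPosed → FreeFermionCalibration → OneFluxQuantum → Assembly → _root_.HubbardSuperconductivity := fun h_TensionForcesCondensate h_HubbardVortexTension h_CondensateIsDWave h_Target h_MagneticTorusWellPosed h_FreeFermionCalibration h_OneFluxQuantum h_Assembly => h_Assembly h_HubbardVortexTension h_TensionForcesCondensate h_CondensateIsDWave

end Summit.HubbardSuperconductivity.HubbardSuperconductivity.Theses.ChernVortexResponse
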